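import HarnessLib
import Literature.NumberTheory.LFunctions.WeilExplicitProofs
import Literature.NumberTheory.LFunctions.WeilArchimedeanPositivityProofs

/-!
# Route SignCone — conditional rungs, I: the tent and its Mellin transform

Support for the conditional rung theorem (items stmt-RiemannHypothesis-16301/16302): numerical RH to height `H` +
an SOS bound for the von Mangoldt comb ⇒ the unit-slack sign-cone inequality at cutoff `½ log N′`; the proof
mollifies a Weil test `g` into `g ⋆ φ`, `φ` a convolution power of the tent. This file: `φ` and its transform.

* `crTent h` — the normalised tent `max 0 (1 - |x|/(2h)) / (2h)` (continuous, support `[-2h, 2h]`, mass 1);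
* `weilMellin_crTent` — `(crTent h)^(s) = sinhc((s - ½) h)²`, `sinhc w = sinh w / w` (`= 1` at `0`);
* `sinhc_mul_I` — on the imaginary axis `sinhc(iu) = sinc u`; `norm_sinhc_le` — `|sinhc w| ≤ cosh(Re w)/|Im w|`.
The convolution powers `crMoll h m` (the actual mollifier) are in `SignConeCondRungMollifier`.
-/

noncomputable section

-- `Summit.RiemannHypothesis.RiemannHypothesis.…` repeats a namespace component by design (D-0017 layout).
set_option linter.dupNamespace false

open scoped BigOperators ComplexConjugate Real Topology
open Complex MeasureTheory Set Filter

namespace Summit.RiemannHypothesis.RiemannHypothesis.Theorems.SignCone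

open Literature.NumberTheory.LFunctions

/-! ### `sinhc` -/

/-- `sinhc w = sinh w / w`, extended by `1` at `w = 0`. [folklore] -/
def sinhc (w : ℂ) : ℂ := if w = 0 then 1 else Complex.sinh w / w

/-- `|sinh (u + iv)| ≤ cosh u`. [folklore] -/
theorem norm_sinh_le_cosh_re (w : ℂ) : ‖Complex.sinh w‖ ≤ Real.cosh w.re := by
  have hw : w = (w.re : ℂ) + (w.im : ℂ) * I := (Complex.re_add_im w).symm
  have hs : Complex.sinh w = (Real.sinh w.re * Real.cos w.im : ℝ) + (Real.cosh w.re * Real.sin w.im : ℝ) * I := by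
    conv_lhs => rw [hw]
    rw [Complex.sinh_add, Complex.sinh_mul_I, Complex.cosh_mul_I]
    push_cast
    rw [← Complex.ofReal_sinh, ← Complex.ofReal_cosh, ← Complex.ofReal_cos, ← Complex.ofReal_sin]
    ring
  have hn : ‖Complex.sinh w‖ ^ 2 = (Real.sinh w.re * Real.cos w.im) ^ 2 + (Real.cosh w.re * Real.sin w.im) ^ 2 := by
    rw [hs, ← Complex.normSq_eq_norm_sq, Complex.normSq_add_mul_I]
  have hc : 0 ≤ Real.cosh w.re := (Real.cosh_pos _).le
  have key : ‖Complex.sinh w‖ ^ 2 ≤ Real.cosh w.re ^ 2 := by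
    rw [hn]
    have h1 : Real.sinh w.re ^ 2 ≤ Real.cosh w.re ^ 2 := by
      nlinarith [Real.cosh_sq w.re, sq_nonneg (Real.sinh w.re)]
    have h2 := Real.sin_sq_add_cos_sq w.im
    nlinarith [sq_nonneg (Real.cos w.im), sq_nonneg (Real.sin w.im), sq_nonneg (Real.sinh w.re)]
  exact (pow_le_pow_iff_left₀ (norm_nonneg _) hc two_ne_zero).1 key


/-- `sinhc 0 = 1`. [folklore] -/
theorem sinhc_zero : sinhc 0 = 1 := by simp [sinhc]
/-- `sinhc w = sinh w / w` for `w ≠ 0`. [folklore] -/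
theorem sinhc_of_ne_zero {w : ℂ} (hw : w ≠ 0) : sinhc w = Complex.sinh w / w := by simp [sinhc, hw]

/-- Off the real axis: `|sinhc w| ≤ cosh (Re w) / |Im w|`. [folklore] -/
theorem norm_sinhc_le {w : ℂ} (hw : w.im ≠ 0) : ‖sinhc w‖ ≤ Real.cosh w.re / |w.im| := by
  have hw0 : w ≠ 0 := fun h => hw (by simp [h])
  rw [sinhc_of_ne_zero hw0, norm_div]
  have h1 : |w.im| ≤ ‖w‖ := Complex.abs_im_le_norm w
  have h2 : 0 < |w.im| := abs_pos.2 hw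
  calc ‖Complex.sinh w‖ / ‖w‖ ≤ Real.cosh w.re / ‖w‖ :=
        div_le_div_of_nonneg_right (norm_sinh_le_cosh_re w) (norm_nonneg _)
    _ ≤ Real.cosh w.re / |w.im| := div_le_div_of_nonneg_left (Real.cosh_pos _).le h2 h1

/-- On the imaginary axis: `sinhc (iu) = sinc u`. [folklore] -/
theorem sinhc_mul_I (u : ℝ) : sinhc (u * I) = (Real.sinc u : ℂ) := by
  by_cases hu : u = 0
  · subst hu; simp [sinhc, Real.sinc]
  · have h0 : (u : ℂ) * I ≠ 0 := mul_ne_zero (Complex.ofReal_ne_zero.2 hu) Complex.I_ne_zero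
    rw [sinhc_of_ne_zero h0, Complex.sinh_mul_I, Real.sinc_of_ne_zero hu, Complex.ofReal_div,
      Complex.ofReal_sin]
    field_simp

/-! ### The tent -/

/-- The normalised tent `max 0 (1 - |x|/(2h)) / (2h)` (mass `1`, support `[-2h, 2h]`), as a complex-valued
function. [folklore] -/
def crTent (h : ℝ) (x : ℝ) : ℂ := ((max 0 (1 - |x| / (2 * h)) / (2 * h) : ℝ) : ℂ)

variable {h : ℝ}

/-- The tent on `[0, 2h]`. [folklore] -/
theorem crTent_apply_of_nonneg (hh : 0 < h) {x : ℝ} (hx0 : 0 ≤ x) (hx : x ≤ 2 * h) :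
    crTent h x = (((1 - x / (2 * h)) / (2 * h) : ℝ) : ℂ) := by
  unfold crTent
  rw [abs_of_nonneg hx0, max_eq_right (by rw [sub_nonneg, div_le_one (by positivity)]; exact hx)]

/-- The tent on `[-2h, 0]`. [folklore] -/
theorem crTent_apply_of_nonpos (hh : 0 < h) {x : ℝ} (hx0 : x ≤ 0) (hx : -(2 * h) ≤ x) :
    crTent h x = (((1 + x / (2 * h)) / (2 * h) : ℝ) : ℂ) := by
  unfold crTent
  rw [abs_of_nonpos hx0, max_eq_right]
  · push_cast; ring
  · rw [sub_nonneg, div_le_one (by positivity)]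
    linarith

/-- The tent vanishes for `|x| ≥ 2h`. [folklore] -/
theorem crTent_eq_zero (hh : 0 < h) {x : ℝ} (hx : 2 * h ≤ |x|) : crTent h x = 0 := by
  unfold crTent
  rw [max_eq_left, zero_div, Complex.ofReal_zero]
  rw [sub_nonpos, one_le_div (by positivity)]
  exact hx

/-- The tent is continuous. [folklore] -/
theorem continuous_crTent (h : ℝ) : Continuous (crTent h) := by
  unfold crTent
  exact Complex.continuous_ofReal.comp
    ((continuous_const.max (continuous_const.sub (continuous_abs.div_const _))).div_const _)

/-- The tent is real and non-negative. [folklore] -/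
theorem crTent_nonneg (hh : 0 < h) (x : ℝ) : 0 ≤ (crTent h x).re ∧ (crTent h x).im = 0 := by
  refine ⟨?_, Complex.ofReal_im _⟩
  show 0 ≤ (((max 0 (1 - |x| / (2 * h)) / (2 * h) : ℝ) : ℂ)).re
  rw [Complex.ofReal_re]
  exact div_nonneg (le_max_left _ _) (by positivity)

/-- `tsupport (crTent h) ⊆ [-2h, 2h]`. [folklore] -/
theorem tsupport_crTent_subset (hh : 0 < h) : tsupport (crTent h) ⊆ Icc (-(2 * h)) (2 * h) := by
  refine closure_minimal (fun x hx => ?_) isClosed_Icc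
  rw [Function.mem_support] at hx
  by_contra hx'
  apply hx (crTent_eq_zero hh ?_)
  rw [mem_Icc, not_and_or, not_le, not_le] at hx'
  rcases hx' with h1 | h1
  · rw [abs_of_neg (by linarith)]; linarith
  · rw [abs_of_pos (by linarith)]; linarith

/-- The tent has compact support. [folklore] -/
theorem hasCompactSupport_crTent (hh : 0 < h) : HasCompactSupport (crTent h) :=
  HasCompactSupport.of_support_subset_isCompact (isCompact_Icc (a := -(2 * h)) (b := 2 * h))
    (subset_tsupport _ |>.trans (tsupport_crTent_subset hh))

/-! ### Mellin transform of the tent -/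

section Mellin

variable (hh : 0 < h)
include hh

omit hh in
/-- `d/dt e^{zt} = z e^{zt}` along the real line. [folklore] -/
private theorem hasDerivAt_cexp_mul (z : ℂ) (t : ℝ) :
    HasDerivAt (fun u : ℝ => cexp (z * u)) (z * cexp (z * t)) t := by
  have h1 : HasDerivAt (fun u : ℝ => z * (u : ℂ)) (z * 1) t := (hasDerivAt_id t).ofReal_comp.const_mul z
  rw [mul_one] at h1
  have := h1.cexp
  simpa [mul_comm] using this

omit hh in
/-- Antiderivative of `e^{zt}(1 - t/2h)/2h` (`z ≠ 0`). [folklore] -/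
private theorem hasDerivAt_Fplus {z : ℂ} (hz : z ≠ 0) (hh : 0 < h) (t : ℝ) :
    HasDerivAt (fun u : ℝ => cexp (z * u) * ((1 - (u : ℂ) / (2 * h)) / (2 * h * z) + 1 / ((2 * h) ^ 2 * z ^ 2)))
      (cexp (z * t) * ((1 - (t : ℂ) / (2 * h)) / (2 * h))) t := by
  have hh' : (h : ℂ) ≠ 0 := Complex.ofReal_ne_zero.2 hh.ne'
  have hA : HasDerivAt (fun u : ℝ => (1 - (u : ℂ) / (2 * h)) / (2 * h * z) + 1 / ((2 * h) ^ 2 * z ^ 2))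
      ((0 - 1 / (2 * h)) / (2 * h * z) + 0) t := by
    refine HasDerivAt.add (HasDerivAt.div_const (HasDerivAt.sub (hasDerivAt_const _ _) ?_) _) (hasDerivAt_const _ _)
    have := (hasDerivAt_id t).ofReal_comp.div_const (2 * (h : ℂ))
    simpa using this
  refine ((hasDerivAt_cexp_mul z t).mul hA).congr_deriv ?_
  field_simp
  ring

omit hh in
/-- Antiderivative of `e^{zt}(1 + t/2h)/2h` (`z ≠ 0`). [folklore] -/
private theorem hasDerivAt_Fminus {z : ℂ} (hz : z ≠ 0) (hh : 0 < h) (t : ℝ) :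
    HasDerivAt (fun u : ℝ => cexp (z * u) * ((1 + (u : ℂ) / (2 * h)) / (2 * h * z) - 1 / ((2 * h) ^ 2 * z ^ 2)))
      (cexp (z * t) * ((1 + (t : ℂ) / (2 * h)) / (2 * h))) t := by
  have hh' : (h : ℂ) ≠ 0 := Complex.ofReal_ne_zero.2 hh.ne'
  have hA : HasDerivAt (fun u : ℝ => (1 + (u : ℂ) / (2 * h)) / (2 * h * z) - 1 / ((2 * h) ^ 2 * z ^ 2))
      ((0 + 1 / (2 * h)) / (2 * h * z) - 0) t := by
    refine HasDerivAt.sub (HasDerivAt.div_const (HasDerivAt.add (hasDerivAt_const _ _) ?_) _) (hasDerivAt_const _ _)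
    have := (hasDerivAt_id t).ofReal_comp.div_const (2 * (h : ℂ))
    simpa using this
  refine ((hasDerivAt_cexp_mul z t).mul hA).congr_deriv ?_
  field_simp
  ring

/-- **Mellin transform of the tent**: `(crTent h)^(s) = sinhc((s - ½) h)²`. [folklore] -/
theorem weilMellin_crTent (s : ℂ) : weilMellin (crTent h) s = sinhc ((s - 1 / 2) * h) ^ 2 := by
  set z : ℂ := s - 1 / 2 with hz_def
  have hh2 : 0 ≤ 2 * h := by positivity
  -- reduce to an interval integral over [-2h, 2h]
  have hzero : ∀ t ∉ Icc (-(2 * h)) (2 * h), crTent h t * cexp ((s - 1 / 2) * t) = 0 := by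
    intro t ht
    rw [crTent_eq_zero hh, zero_mul]
    rw [mem_Icc, not_and_or, not_le, not_le] at ht
    rcases ht with h1 | h1
    · rw [abs_of_neg (by linarith)]; linarith
    · rw [abs_of_pos (by linarith)]; linarith
  unfold weilMellin
  rw [← setIntegral_eq_integral_of_forall_compl_eq_zero hzero, integral_Icc_eq_integral_Ioc,
    ← intervalIntegral.integral_of_le (by linarith)]
  -- integrability of the integrand on intervals
  have hcont : Continuous fun t : ℝ => crTent h t * cexp ((s - 1 / 2) * t) :=
    (continuous_crTent h).mul (by fun_prop)
  have hii : ∀ a b : ℝ, IntervalIntegrable (fun t : ℝ => crTent h t * cexp ((s - 1 / 2) * t)) volume a b :=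
    fun a b => hcont.intervalIntegrable a b
  rw [← intervalIntegral.integral_add_adjacent_intervals (hii (-(2 * h)) 0) (hii 0 (2 * h))]
  by_cases hz : z = 0
  · -- s = 1/2: the mass of the tent is 1
    have hs : s - 1 / 2 = 0 := hz
    simp only [hs, zero_mul, Complex.exp_zero, mul_one]
    rw [hz, zero_mul, sinhc_zero, one_pow]
    have e1 : ∫ t in (-(2 * h))..0, crTent h t = ∫ t in (-(2 * h))..0, (((1 + t / (2 * h)) / (2 * h) : ℝ) : ℂ) := by
      refine intervalIntegral.integral_congr fun t ht => ?_
      rw [uIcc_of_le (by linarith), mem_Icc] at ht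
      exact crTent_apply_of_nonpos hh ht.2 ht.1
    have e2 : ∫ t in (0 : ℝ)..(2 * h), crTent h t = ∫ t in (0 : ℝ)..(2 * h), (((1 - t / (2 * h)) / (2 * h) : ℝ) : ℂ) := by
      refine intervalIntegral.integral_congr fun t ht => ?_
      rw [uIcc_of_le hh2, mem_Icc] at ht
      exact crTent_apply_of_nonneg hh ht.1 ht.2
    rw [e1, e2, intervalIntegral.integral_ofReal, intervalIntegral.integral_ofReal]
    have i1 : ∫ t in (-(2 * h))..0, (1 + t / (2 * h)) / (2 * h) = 1 / 2 := by
      rw [intervalIntegral.integral_div, intervalIntegral.integral_add intervalIntegrable_const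
        ((by fun_prop : Continuous fun t : ℝ => t / (2 * h)).intervalIntegrable _ _),
        intervalIntegral.integral_const, intervalIntegral.integral_div, integral_id, smul_eq_mul]
      field_simp
      ring
    have i2 : ∫ t in (0 : ℝ)..(2 * h), (1 - t / (2 * h)) / (2 * h) = 1 / 2 := by
      rw [intervalIntegral.integral_div, intervalIntegral.integral_sub intervalIntegrable_const
        ((by fun_prop : Continuous fun t : ℝ => t / (2 * h)).intervalIntegrable _ _),
        intervalIntegral.integral_const, intervalIntegral.integral_div, integral_id, smul_eq_mul]
      field_simp
      ring
    rw [i1, i2]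
    norm_num
  · -- z ≠ 0: fundamental theorem of calculus on the two halves
    have hzh : z * h ≠ 0 := mul_ne_zero hz (Complex.ofReal_ne_zero.2 hh.ne')
    have e1 : ∫ t in (-(2 * h))..0, crTent h t * cexp ((s - 1 / 2) * t) =
        ∫ t in (-(2 * h))..0, cexp (z * t) * ((1 + (t : ℂ) / (2 * h)) / (2 * h)) := by
      refine intervalIntegral.integral_congr fun t ht => ?_
      rw [uIcc_of_le (by linarith), mem_Icc] at ht
      rw [crTent_apply_of_nonpos hh ht.2 ht.1, ← hz_def]
      push_cast
      ring
    have e2 : ∫ t in (0 : ℝ)..(2 * h), crTent h t * cexp ((s - 1 / 2) * t) =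
        ∫ t in (0 : ℝ)..(2 * h), cexp (z * t) * ((1 - (t : ℂ) / (2 * h)) / (2 * h)) := by
      refine intervalIntegral.integral_congr fun t ht => ?_
      rw [uIcc_of_le hh2, mem_Icc] at ht
      rw [crTent_apply_of_nonneg hh ht.1 ht.2, ← hz_def]
      push_cast
      ring
    have hh' : (h : ℂ) ≠ 0 := Complex.ofReal_ne_zero.2 hh.ne'
    have I1 : ∫ t in (-(2 * h))..0, cexp (z * t) * ((1 + (t : ℂ) / (2 * h)) / (2 * h)) =
        1 / (2 * h * z) - 1 / ((2 * h) ^ 2 * z ^ 2) + cexp (-(z * h)) ^ 2 / ((2 * h) ^ 2 * z ^ 2) := by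
      rw [intervalIntegral.integral_eq_sub_of_hasDerivAt (fun t _ => hasDerivAt_Fminus hz hh t)
        ((Continuous.intervalIntegrable (by fun_prop) _ _))]
      have ex2 : cexp (z * ((-(2 * h) : ℝ) : ℂ)) = cexp (-(z * h)) ^ 2 := by
        rw [← Complex.exp_nat_mul]; push_cast; ring_nf
      rw [ex2]
      push_cast
      rw [mul_zero, Complex.exp_zero]
      field_simp
      ring
    have I2 : ∫ t in (0 : ℝ)..(2 * h), cexp (z * t) * ((1 - (t : ℂ) / (2 * h)) / (2 * h)) =
        cexp (z * h) ^ 2 / ((2 * h) ^ 2 * z ^ 2) - 1 / (2 * h * z) - 1 / ((2 * h) ^ 2 * z ^ 2) := by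
      rw [intervalIntegral.integral_eq_sub_of_hasDerivAt (fun t _ => hasDerivAt_Fplus hz hh t)
        ((Continuous.intervalIntegrable (by fun_prop) _ _))]
      have ex1 : cexp (z * ((2 * h : ℝ) : ℂ)) = cexp (z * h) ^ 2 := by
        rw [← Complex.exp_nat_mul]; push_cast; ring_nf
      rw [ex1]
      push_cast
      rw [mul_zero, Complex.exp_zero]
      field_simp
      ring
    rw [e1, e2, I1, I2, sinhc_of_ne_zero hzh, Complex.sinh, Complex.exp_neg]
    have hE : cexp (z * h) ≠ 0 := Complex.exp_ne_zero _
    field_simp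
    ring

end Mellin


end Summit.RiemannHypothesis.RiemannHypothesis.Theorems.SignCone

end
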